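import Summits.AtomisticToContinuum.HydrodynamicLimit.Theorems.LambertianContactSwapLambertianWellPosedHalfAngle

/-!
# The incoming flux law of the Lambertian redraw

Helper file (`--supports`) of the support item `LambertianWellPosed` of route `LambertianContactSwap`
(`AtomisticToContinuum/HydrodynamicLimit`, stmt-AtomisticToContinuum-12101); part of the chain
HalfAngle → FluxLaw → Cylinder → PhaseLift → JInv proving that the Lambertian pre-kick of a pair preserves
`vol ⊗ γ` on the good pair data (the cosine law of the redraw). See the docstrings of the declarations.
-/

noncomputable section

open MeasureTheory ProbabilityTheory Set Function Filter Metric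
open scoped ENNReal InnerProductSpace Real

namespace Summit.AtomisticToContinuum.HydrodynamicLimit.Theorems

open Literature.MathematicalPhysics.KineticTheory Literature.Analysis.FluidPDE
  Literature.Analysis.FluidPDE.Alexander

namespace HalfAngle

/-! ## The reflected direction and the incoming flux law -/

section Reflected

variable {V : Type*} [NormedAddCommGroup V] [InnerProductSpace ℝ V]
  {W : Type*} [NormedAddCommGroup W] [InnerProductSpace ℝ W]

/-- **Equivariance of the Lambertian direction** under linear isometries:
`L (lambertDir ω ξ) = lambertDir (L ω) (L ξ)`. [folklore] -/
theorem map_lambertDir (L : V ≃ₗᵢ[ℝ] W) (ω ξ : V) : L (lambertDir ω ξ) = lambertDir (L ω) (L ξ) := by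
  have hu : ‖ω‖⁻¹ • L ω + ‖ξ‖⁻¹ • L ξ = L (‖ω‖⁻¹ • ω + ‖ξ‖⁻¹ • ξ) := by simp only [map_add, map_smul]
  simp only [lambertDir, LinearIsometryEquiv.norm_map]
  rw [hu, LinearIsometryEquiv.norm_map, map_smul]

/-- The reflection of `ℝ³` across the plane orthogonal to `ν`, written out:
`ρ_ν y = y − (2⟪y, ν⟫/‖ν‖²) ν`. [folklore] -/
theorem reflection_orthogonal_singleton_apply (ν y : V) :
    (ℝ ∙ ν)ᗮ.reflection y = y - (2 * ⟪y, ν⟫_ℝ / ‖ν‖ ^ 2) • ν := by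
  rw [Submodule.reflection_orthogonal_apply, Submodule.reflection_singleton_apply, real_inner_comm ν y,
    neg_sub, two_nsmul, ← add_smul]
  congr 1
  simp only [RCLike.ofReal_real_eq_id, id_eq]
  ring

/-- The reflected Lambertian direction is the Lambertian direction about `-ν` of the reflected
noise: `ρ_ν (lambertDir ν ξ) = lambertDir (-ν) (ρ_ν ξ)` (unit `ν`). [folklore] -/
theorem reflection_lambertDir (ν ξ : V) :
    (ℝ ∙ ν)ᗮ.reflection (lambertDir ν ξ) = lambertDir (-ν) ((ℝ ∙ ν)ᗮ.reflection ξ) := by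
  rw [map_lambertDir, Submodule.reflection_orthogonalComplement_singleton_eq_neg]

end Reflected

/-- **The incoming half-angle law**: for unit `ν` and measurable `f ≥ 0`,
`∫ f(ρ_ν (lambertDir ν ξ)) dγ(ξ) = π⁻¹ ∫_{S²} (−⟪θ, ν⟫)₊ f(θ) dσ(θ)` — reflecting the redrawn
direction across `νᗮ` gives the cosine law on the incoming hemisphere (invariance of the Gaussian
under the reflection, `ProbabilityTheory.stdGaussian_map`, and the half-angle law about `-ν`).
[folklore] -/
theorem lintegral_reflection_lambertDir_stdGaussian {ν : EuclideanSpace ℝ (Fin 3)} (hν : ‖ν‖ = 1)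
    {f : EuclideanSpace ℝ (Fin 3) → ℝ≥0∞} (hf : Measurable f) :
    ∫⁻ ξ, f ((ℝ ∙ ν)ᗮ.reflection (lambertDir ν ξ)) ∂(stdGaussian (EuclideanSpace ℝ (Fin 3))) =
      (ENNReal.ofReal π)⁻¹ * ∫⁻ θ : sphere (0 : EuclideanSpace ℝ (Fin 3)) 1,
        ENNReal.ofReal (-⟪(θ : EuclideanSpace ℝ (Fin 3)), ν⟫_ℝ) * f θ ∂(volume.toSphere) := by
  simp_rw [reflection_lambertDir]
  set ρ : EuclideanSpace ℝ (Fin 3) ≃ₗᵢ[ℝ] EuclideanSpace ℝ (Fin 3) := (ℝ ∙ ν)ᗮ.reflection with hρ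
  have hmap : (stdGaussian (EuclideanSpace ℝ (Fin 3))).map ρ = stdGaussian (EuclideanSpace ℝ (Fin 3)) :=
    stdGaussian_map ρ
  have hmeas : Measurable fun ξ : EuclideanSpace ℝ (Fin 3) => f (lambertDir (-ν) ξ) :=
    hf.comp (measurable_const.lambertDir measurable_id)
  calc ∫⁻ ξ, f (lambertDir (-ν) (ρ ξ)) ∂(stdGaussian (EuclideanSpace ℝ (Fin 3)))
      = ∫⁻ ξ, f (lambertDir (-ν) ξ) ∂((stdGaussian (EuclideanSpace ℝ (Fin 3))).map ρ) := by
        rw [lintegral_map hmeas ρ.continuous.measurable]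
    _ = ∫⁻ ξ, f (lambertDir (-ν) ξ) ∂(stdGaussian (EuclideanSpace ℝ (Fin 3))) := by rw [hmap]
    _ = (ENNReal.ofReal π)⁻¹ * ∫⁻ θ : sphere (0 : EuclideanSpace ℝ (Fin 3)) 1,
          ENNReal.ofReal ⟪(θ : EuclideanSpace ℝ (Fin 3)), -ν⟫_ℝ * f θ ∂(volume.toSphere) :=
        lintegral_lambertDir_stdGaussian (by rw [norm_neg, hν]) hf
    _ = _ := by simp_rw [inner_neg_right]

/-- The total incoming flux is `π`: `∫_{S²} (−⟪θ, ν⟫)₊ dσ(θ) = π` (unit `ν`). [folklore] -/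
theorem lintegral_toSphere_cos_neg {ν : EuclideanSpace ℝ (Fin 3)} (hν : ‖ν‖ = 1) :
    ∫⁻ θ : sphere (0 : EuclideanSpace ℝ (Fin 3)) 1,
      ENNReal.ofReal (-⟪(θ : EuclideanSpace ℝ (Fin 3)), ν⟫_ℝ) ∂(volume.toSphere) = ENNReal.ofReal π := by
  simp_rw [← inner_neg_right, real_inner_comm (-ν)]
  exact lintegral_toSphere_cos (a := -ν) (by rw [norm_neg, hν])

/-- **The incoming flux law of a Lambertian redraw**: for unit `ν` and measurable `h ≥ 0` on `ℝ³`,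
`∫ (−⟪w, ν⟫)₊ ∫ h(‖w‖ ρ_ν(lambertDir ν ξ)) dγ(ξ) dw = ∫ (−⟪w, ν⟫)₊ h(w) dw`: redrawing the
direction of an incoming relative velocity `w` (keeping its speed) by the reflected Lambertian direction
preserves the incoming flux measure `(−⟪w, ν⟫)₊ dw` (polar coordinates and the incoming half-angle law
on each sphere `‖w‖ = s`). [folklore] -/
theorem lintegral_flux_redraw {ν : EuclideanSpace ℝ (Fin 3)} (hν : ‖ν‖ = 1)
    {h : EuclideanSpace ℝ (Fin 3) → ℝ≥0∞} (hh : Measurable h) :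
    ∫⁻ w, ENNReal.ofReal (-⟪w, ν⟫_ℝ) *
        ∫⁻ ξ, h (‖w‖ • (ℝ ∙ ν)ᗮ.reflection (lambertDir ν ξ)) ∂(stdGaussian (EuclideanSpace ℝ (Fin 3))) =
      ∫⁻ w, ENNReal.ofReal (-⟪w, ν⟫_ℝ) * h w := by
  set ρ : EuclideanSpace ℝ (Fin 3) ≃ₗᵢ[ℝ] EuclideanSpace ℝ (Fin 3) := (ℝ ∙ ν)ᗮ.reflection with hρ
  set γ : Measure (EuclideanSpace ℝ (Fin 3)) := stdGaussian (EuclideanSpace ℝ (Fin 3)) with hγ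
  -- the radial function `I s = ∫ h(s ρ(lambertDir ν ξ)) dγ(ξ)`
  have hHm : Measurable fun p : ℝ × EuclideanSpace ℝ (Fin 3) => h (p.1 • ρ (lambertDir ν p.2)) :=
    hh.comp (measurable_fst.smul (ρ.continuous.measurable.comp (measurable_const.lambertDir measurable_snd)))
  have hI : Measurable fun s : ℝ => ∫⁻ ξ, h (s • ρ (lambertDir ν ξ)) ∂γ := hHm.lintegral_prod_right'
  -- the incoming half-angle law on the sphere of radius `s`
  have hsphere : ∀ s : ℝ, ∫⁻ θ : sphere (0 : EuclideanSpace ℝ (Fin 3)) 1,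
      ENNReal.ofReal (-⟪(θ : EuclideanSpace ℝ (Fin 3)), ν⟫_ℝ) * h (s • (θ : EuclideanSpace ℝ (Fin 3)))
        ∂(volume.toSphere) = ENNReal.ofReal π * ∫⁻ ξ, h (s • ρ (lambertDir ν ξ)) ∂γ := by
    intro s
    have hπ : ENNReal.ofReal π ≠ 0 := (ENNReal.ofReal_pos.2 Real.pi_pos).ne'
    rw [lintegral_reflection_lambertDir_stdGaussian hν (f := fun y => h (s • y)) (hh.comp (measurable_id.const_smul s)),
      ← mul_assoc, ENNReal.mul_inv_cancel hπ ENNReal.ofReal_ne_top, one_mul]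
  -- left side in polar coordinates
  have hLm : Measurable fun w : EuclideanSpace ℝ (Fin 3) => ENNReal.ofReal (-⟪w, ν⟫_ℝ) *
      ∫⁻ ξ, h (‖w‖ • ρ (lambertDir ν ξ)) ∂γ :=
    (measurable_id.inner measurable_const).neg.ennreal_ofReal.mul (hI.comp measurable_norm)
  have hRm : Measurable fun w : EuclideanSpace ℝ (Fin 3) => ENNReal.ofReal (-⟪w, ν⟫_ℝ) * h w :=
    (measurable_id.inner measurable_const).neg.ennreal_ofReal.mul hh
  rw [lintegral_polar volume _ hLm, lintegral_polar volume _ hRm]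
  -- inner integrals
  have hθ1 : ∀ θ : sphere (0 : EuclideanSpace ℝ (Fin 3)) 1, ‖(θ : EuclideanSpace ℝ (Fin 3))‖ = 1 := fun θ => by simp
  have key : ∀ (θ : sphere (0 : EuclideanSpace ℝ (Fin 3)) 1) (s : ℝ), 0 < s →
      ENNReal.ofReal (-⟪s • (θ : EuclideanSpace ℝ (Fin 3)), ν⟫_ℝ) =
        ENNReal.ofReal s * ENNReal.ofReal (-⟪(θ : EuclideanSpace ℝ (Fin 3)), ν⟫_ℝ) := by
    intro θ s hs
    rw [inner_smul_left, RCLike.conj_to_real, ← mul_neg, ENNReal.ofReal_mul hs.le]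
  set A : ℝ → ℝ≥0∞ := fun s => ENNReal.ofReal (s ^ (Module.finrank ℝ (EuclideanSpace ℝ (Fin 3)) - 1))
    with hA
  have hAm : Measurable A := Measurable.ennreal_ofReal (measurable_id.pow_const _)
  set J : ℝ≥0∞ := ∫⁻ s in Ioi (0 : ℝ), A s * (ENNReal.ofReal s * ∫⁻ ξ, h (s • ρ (lambertDir ν ξ)) ∂γ)
    with hJ
  have hJm : Measurable fun s : ℝ => A s * (ENNReal.ofReal s * ∫⁻ ξ, h (s • ρ (lambertDir ν ξ)) ∂γ) :=
    hAm.mul ((Measurable.ennreal_ofReal measurable_id).mul hI)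
  have hcm : Measurable fun θ : sphere (0 : EuclideanSpace ℝ (Fin 3)) 1 =>
      ENNReal.ofReal (-⟪(θ : EuclideanSpace ℝ (Fin 3)), ν⟫_ℝ) :=
    (measurable_subtype_coe.inner measurable_const).neg.ennreal_ofReal
  -- the left side equals `π J`
  have hL : ∀ θ : sphere (0 : EuclideanSpace ℝ (Fin 3)) 1, ∫⁻ s in Ioi (0 : ℝ),
      A s * (ENNReal.ofReal (-⟪s • (θ : EuclideanSpace ℝ (Fin 3)), ν⟫_ℝ) *
          ∫⁻ ξ, h (‖s • (θ : EuclideanSpace ℝ (Fin 3))‖ • ρ (lambertDir ν ξ)) ∂γ) =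
      ENNReal.ofReal (-⟪(θ : EuclideanSpace ℝ (Fin 3)), ν⟫_ℝ) * J := by
    intro θ
    rw [hJ, ← lintegral_const_mul _ hJm]
    refine setLIntegral_congr_fun measurableSet_Ioi fun s hs => ?_
    have hs : 0 < s := hs
    rw [key θ s hs, norm_smul, hθ1 θ, mul_one, Real.norm_of_nonneg hs.le]
    ring
  have hLHS : ∫⁻ θ : sphere (0 : EuclideanSpace ℝ (Fin 3)) 1, (∫⁻ s in Ioi (0 : ℝ),
      A s * (ENNReal.ofReal (-⟪s • (θ : EuclideanSpace ℝ (Fin 3)), ν⟫_ℝ) *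
          ∫⁻ ξ, h (‖s • (θ : EuclideanSpace ℝ (Fin 3))‖ • ρ (lambertDir ν ξ)) ∂γ)) ∂(volume.toSphere) =
      ENNReal.ofReal π * J := by
    simp_rw [hL]
    rw [lintegral_mul_const _ hcm, lintegral_toSphere_cos_neg hν]
  -- the right side equals `π J` too
  have hR : ∀ θ : sphere (0 : EuclideanSpace ℝ (Fin 3)) 1, ∫⁻ s in Ioi (0 : ℝ),
      A s * (ENNReal.ofReal (-⟪s • (θ : EuclideanSpace ℝ (Fin 3)), ν⟫_ℝ) * h (s • (θ : EuclideanSpace ℝ (Fin 3)))) =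
      ∫⁻ s in Ioi (0 : ℝ), ENNReal.ofReal (-⟪(θ : EuclideanSpace ℝ (Fin 3)), ν⟫_ℝ) *
        (A s * (ENNReal.ofReal s * h (s • (θ : EuclideanSpace ℝ (Fin 3))))) := by
    intro θ
    refine setLIntegral_congr_fun measurableSet_Ioi fun s hs => ?_
    have hs : 0 < s := hs
    rw [key θ s hs]
    ring
  have hFm : Measurable fun p : sphere (0 : EuclideanSpace ℝ (Fin 3)) 1 × ℝ =>
      ENNReal.ofReal (-⟪(p.1 : EuclideanSpace ℝ (Fin 3)), ν⟫_ℝ) *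
        (A p.2 * (ENNReal.ofReal p.2 * h (p.2 • (p.1 : EuclideanSpace ℝ (Fin 3))))) :=
    ((measurable_subtype_coe.comp measurable_fst).inner measurable_const).neg.ennreal_ofReal.mul
      ((hAm.comp measurable_snd).mul ((Measurable.ennreal_ofReal measurable_snd).mul
        (hh.comp (measurable_snd.smul (measurable_subtype_coe.comp measurable_fst)))))
  have hinner : ∀ s : ℝ, ∫⁻ θ : sphere (0 : EuclideanSpace ℝ (Fin 3)) 1,
      ENNReal.ofReal (-⟪(θ : EuclideanSpace ℝ (Fin 3)), ν⟫_ℝ) *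
        (A s * (ENNReal.ofReal s * h (s • (θ : EuclideanSpace ℝ (Fin 3))))) ∂(volume.toSphere) =
      A s * (ENNReal.ofReal s * (ENNReal.ofReal π * ∫⁻ ξ, h (s • ρ (lambertDir ν ξ)) ∂γ)) := by
    intro s
    have hm : Measurable fun θ : sphere (0 : EuclideanSpace ℝ (Fin 3)) 1 =>
        ENNReal.ofReal (-⟪(θ : EuclideanSpace ℝ (Fin 3)), ν⟫_ℝ) * h (s • (θ : EuclideanSpace ℝ (Fin 3))) :=
      hcm.mul (hh.comp (measurable_subtype_coe.const_smul s))
    rw [← hsphere s, ← mul_assoc, ← lintegral_const_mul _ hm]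
    refine lintegral_congr fun θ => ?_
    ring
  have hRHS : ∫⁻ θ : sphere (0 : EuclideanSpace ℝ (Fin 3)) 1, (∫⁻ s in Ioi (0 : ℝ),
      A s * (ENNReal.ofReal (-⟪s • (θ : EuclideanSpace ℝ (Fin 3)), ν⟫_ℝ) *
        h (s • (θ : EuclideanSpace ℝ (Fin 3))))) ∂(volume.toSphere) = ENNReal.ofReal π * J := by
    simp_rw [hR]
    rw [lintegral_lintegral_swap hFm.aemeasurable]
    simp_rw [hinner]
    rw [hJ, ← lintegral_const_mul _ hJm]
    refine setLIntegral_congr_fun measurableSet_Ioi fun s _ => ?_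
    ring
  rw [hLHS, hRHS]




end HalfAngle

end Summit.AtomisticToContinuum.HydrodynamicLimit.Theorems
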